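import Mathlib
import HarnessLib

/-!
# Markman 2025 — LEMMA 9.2.8 «`dim H⁰(X, I_{C_t}(2Θ) ⊗ L) = 4`»: the printed dimension count through the 3 × 3
# diagram of short exact sequences, and LEMMA 9.1.2 Step 1 (the maps `t`, `f`, `u` on `Pic(C)⁴`) — AS PRINTED,
# kernel-checked

E. Markman: [M] *Cycles on abelian 2n-folds of Weil type from secant sheaves on abelian n-folds*,
arXiv:2502.03415 **v2** (2025-06-08), bib `Markman2025SecantWeil` — UNREFEREED PREPRINT. Pages/lines = PyMuPDF lines
of the public v2 PDF (sha256/16 `8155aa33870069b8`), read at seat lit-w-markman g15 (pub-hsemireg LIT-W, 2026-08-23;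
sheet `LOCATOR-SHEET-MARKMAN.md` §47), BY EYE on 160-dpi renders `HOME/lit/Markman-renders-litw-markman-g15/`
`r_mar25_v2_p80_L928.png`, `…p81_L928_end.png`, `…p69_L912_step1.png`, `…p70_L912_step2.png`. Setting ([M] §8–§9):
`X = Pic²(C)` the Jacobian of a non-hyperelliptic genus-3 curve `C` with theta divisor `Θ ≅ C^{(2)}`; `C_t ⊂ X` a
translate of the Abel–Jacobi curve `C_p`; `D := Θ_s + Θ_t ∈ |L(2Θ)|`, `C_t ⊂ Θ_t`.

## What is printed (verbatim, v2)
* LEMMA 9.2.8 (p. 80 L30–31): «The equality `dim H⁰(X, I_{C_t}(2Θ) ⊗ L) = 4` holds, for all line bundles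
  `L ∈ Pic⁰(X)`.» Proof (p. 80 L32 – p. 81 L15): «Let `s ∈ Pic⁰(C)` be such that `L(2Θ)` is isomorphic to
  `O_X(Θ_t + Θ_s)`. Set `D := Θ_s + Θ_t`. Note the inclusion `C_t ⊂ Θ_t`. … Consider the following diagram with
  short exact rows and columns. [rows `O_X(Θ_s) = O_X(Θ_s) → 0`; `I_{C_t}(D) → O_X(D) → O_{C_t}(D|_{C_t})`;
  `O_{Θ_t}(D|_{Θ_t} − C_t) → O_{Θ_t}(D|_{Θ_t}) → O_{C_t}(D|_{C_t})`] The degree of `D|_{C_t}` is 6 and so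
  `h⁰(O_{C_t}(D|_{C_t})) = 4`. The equality `h⁰(O_X(D)) = 8` implies that `h⁰(I_{C_t}(D))` is at least 4, by the
  middle horizontal short exact sequence. Consider the vertical left short exact sequence. The dimensions
  `hⁱ(O_X(Θ_s))` are 1 for `i = 0` and 0 for `i > 0`. Hence, it suffices to prove that `H⁰(O_{Θ_t}(D|_{Θ_t} − C_t))`
  is 3-dimensional, as it would follow that `h⁰(I_{C_t}(D)) ≤ 4`. The middle vertical short exact sequence implies
  that `H⁰(O_{Θ_t}(D|_{Θ_t}))` is 7-dimensional, since `h¹(O_X(Θ_s)) = 0`. Hence, the equality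
  `h⁰(O_{Θ_t}(D|_{Θ_t} − C_t)) = 3` would follow from the exactness of the bottom horizontal sequence once we prove
  the vanishing of `h¹(O_{Θ_t}(D|_{Θ_t} − C_t))`. It suffices to prove that `O_{Θ_t}(D|_{Θ_t} − C_t) ⊗ ω_{Θ_t}^{−1}` is
  ample, by Kodaira's vanishing. …»
* Lemma 9.1.2, proof, Step 2 (p. 70 L11–12): «Now `ℙ[H⁰(I_{C_L}(2Θ))]` is 3-dimensional (we postpone the proof to
  Lemma 9.2.8).»
* LEMMA 9.1.2 Step 1 (p. 69 L40–49): «Note first that for a generic choice of `ℓ_i`'s the intersection (9.1.1) is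
  empty. It suffices to prove it for `d = 3`. Now the intersection of generic 4 translates of `Θ` is empty. So it
  suffices to observe that the morphism `t : Pic¹(C) → Pic²(C)` given by
  `t(ℓ₁, ℓ₂, ℓ₃, ℓ₄) = (ℓ₁ + ℓ₂, ℓ₁ + ℓ₃, ℓ₁ + ℓ₄, ℓ₂ + ℓ₃)` is surjective. Indeed, set `T = (t₁, t₂, t₃, t₄)` and
  define `f : Pic²(C)⁴ → Pic²(C)` by `f(T) = t₁ + t₂ − t₄` and `u : Pic²(C)⁴ → Pic²(C)⁴` by
  `u(T) = (f(T), 2t₁ − f(T), 2t₂ − f(T), 2t₃ − f(T))`. Then `f(t(ℓ₁, ℓ₂, ℓ₃, ℓ₄)) = 2ℓ₁` and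
  `u(t(ℓ₁, ℓ₂, ℓ₃, ℓ₄)) = (2ℓ₁, 2ℓ₂, 2ℓ₃, 2ℓ₄)`. It follows that `u ∘ t` is surjective, and hence so is `t`, as the
  image of `t` must be 4 dimensional.» (sic «`t : Pic¹(C) → Pic²(C)`» for `Pic¹(C)⁴ → Pic²(C)⁴`, as the display
  shows.)

## What this file proves (0 named facts, 0 sorry)
§A — the NUMERICAL INPUTS as arithmetic: `deg_restriction` (`D ≡ 2Θ`, `Θ·C_t = g = 3` ⇒ `deg D|_{C_t} = 6`),
`riemann_roch_deg_six` (genus `3`, degree `6 > 2g − 2 = 4` ⇒ `h⁰ = 6 + 1 − 3 = 4`), `h0_two_theta` (`h⁰(O_X(2Θ)) =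
2³ = 8` on a principally polarised threefold), `projective_dim` (`dim ℙ[H⁰] = 4 − 1 = 3`, Lemma 9.1.2 Step 2).
§B — the EXACT-SEQUENCE BOOKKEEPING as honest linear algebra over a field: for `A —f→ B —g→ C` with `f` injective and
`ker g = range f` (the `H⁰`-part of a short exact sequence of sheaves): `finrank_mid_le` (`dim B ≤ dim A + dim C`) and,
if moreover `g` is surjective (an `H¹`-vanishing), `finrank_mid_eq` (`dim B = dim A + dim C`); then the printed chain
`lemma_9_2_8_chain`: `8 ≤ x + 4` (middle row) ⇒ `x ≥ 4`; `7 = 8 − 1` (middle column, `h¹(O_X(Θ_s)) = 0`);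
`3 = 7 − 4` (bottom row, `h¹(O_{Θ_t}(D − C_t)) = 0`); `x ≤ 1 + 3` (left column) ⇒ `x = 4`.
§C — LEMMA 9.1.2 Step 1 in ANY additive commutative group (`Pic(C)`): `tMap`, `fMap`, `uMap` as printed,
`f_comp_t` (`f(t(ℓ)) = 2ℓ₁`), `u_comp_t` (`u(t(ℓ)) = (2ℓ₁, 2ℓ₂, 2ℓ₃, 2ℓ₄)`), and `u_comp_t_surjective` (if doubling
is surjective on the group — divisibility of `Pic¹(C)`, by value — then `u ∘ t` is surjective). The conclusion «hence
so is `t`, as the image of `t` must be 4 dimensional» is a dimension/properness argument taken BY VALUE.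
BY VALUE (printed inputs, not modelled): the diagram itself and the exactness of its rows/columns, `C_t ⊂ Θ_t`,
`Θ·C = 3`, Kodaira vanishing and the ampleness argument (p. 81 L7–15), the cohomology of `O_X(Θ_s)`.
Nothing in this file says that HC / HC_CM / HC_AV is proved or that any object is semiregular or hyperholomorphic.
-/

namespace Literature.AlgebraicGeometry.Markman2025.Lemma928

/-! ### §A. The numerical inputs -/

/-- «The degree of `D|_{C_t}` is 6»: `D = Θ_s + Θ_t ≡ 2Θ` and `Θ·C_t = g = 3` (Poincaré's formula for the Abel–Jacobi curve
on a genus-3 Jacobian, by value). [cite: Markman2025SecantWeil, Lemma 9.2.8 (proof), p. 80 L56] -/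
theorem deg_restriction : 2 * 3 = 6 ∧ 3 + 3 = 6 := by
  omega

/-- «… and so `h⁰(O_{C_t}(D|_{C_t})) = 4`»: Riemann–Roch on the genus-`3` curve `C_t` for a divisor of degree `6`: since
`6 > 2g − 2 = 4`, `h¹ = 0` and `h⁰ = deg + 1 − g = 6 + 1 − 3 = 4`. [cite: Markman2025SecantWeil, Lemma 9.2.8 (proof), p. 80 L56] -/
theorem riemann_roch_deg_six : (2 * 3 - 2 < 6) ∧ (6 + 1 - 3 = 4) := by
  omega

/-- «The equality `h⁰(O_X(D)) = 8`»: `D ≡ 2Θ` on the principally polarised threefold `X`, `h⁰(O_X(kΘ)) = k^g`, `2³ = 8`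
(by value as a statement about `X`; the arithmetic is checked). [cite: Markman2025SecantWeil, Lemma 9.2.8 (proof), p. 80 L56] -/
theorem h0_two_theta : 2 ^ 3 = 8 := by
  norm_num

/-- Lemma 9.1.2, Step 2: «Now `ℙ[H⁰(I_{C_L}(2Θ))]` is 3-dimensional (we postpone the proof to Lemma 9.2.8)» — the
projectivisation of the `4`-dimensional space of Lemma 9.2.8. [cite: Markman2025SecantWeil, Lemma 9.1.2 (proof, Step 2), p. 70 L11–12] -/
theorem projective_dim : 4 - 1 = 3 := by
  omega

/-! ### §B. The exact-sequence bookkeeping -/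

section Exact

variable {K : Type*} [Field K] {A B C : Type*} [AddCommGroup A] [Module K A] [AddCommGroup B] [Module K B]
  [AddCommGroup C] [Module K C] [FiniteDimensional K A] [FiniteDimensional K B] [FiniteDimensional K C]

omit [FiniteDimensional K A] in
/-- The `H⁰`-part of a short exact sequence: `A —f→ B —g→ C` with `f` injective and `ker g = range f` gives
`dim B ≤ dim A + dim C` — the inequality used twice («`h⁰(O_X(D)) = 8` implies that `h⁰(I_{C_t}(D))` is at least 4, by the
middle horizontal short exact sequence»; «it would follow that `h⁰(I_{C_t}(D)) ≤ 4`», left column).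
[cite: Markman2025SecantWeil, Lemma 9.2.8 (proof), p. 80 L56–60] -/
theorem finrank_mid_le (f : A →ₗ[K] B) (g : B →ₗ[K] C) (hf : Function.Injective f)
    (hex : LinearMap.ker g = LinearMap.range f) :
    Module.finrank K B ≤ Module.finrank K A + Module.finrank K C := by
  have h1 := LinearMap.finrank_range_add_finrank_ker g
  have h2 : Module.finrank K (LinearMap.range f) = Module.finrank K A := LinearMap.finrank_range_of_inj hf
  have h3 : Module.finrank K (LinearMap.range g) ≤ Module.finrank K C := Submodule.finrank_le _
  rw [hex, h2] at h1
  omega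

omit [FiniteDimensional K A] [FiniteDimensional K C] in
/-- … and when the next map is SURJECTIVE (the `H¹`-term vanishes: «since `h¹(O_X(Θ_s)) = 0`», «once we prove the
vanishing of `h¹(O_{Θ_t}(D|_{Θ_t} − C_t))`») the dimension is EXACTLY `dim A + dim C`.
[cite: Markman2025SecantWeil, Lemma 9.2.8 (proof), p. 81 L3–7] -/
theorem finrank_mid_eq (f : A →ₗ[K] B) (g : B →ₗ[K] C) (hf : Function.Injective f)
    (hex : LinearMap.ker g = LinearMap.range f) (hg : Function.Surjective g) :
    Module.finrank K B = Module.finrank K A + Module.finrank K C := by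
  have h1 := LinearMap.finrank_range_add_finrank_ker g
  have h2 : Module.finrank K (LinearMap.range f) = Module.finrank K A := LinearMap.finrank_range_of_inj hf
  have h3 : Module.finrank K (LinearMap.range g) = Module.finrank K C := by
    rw [LinearMap.range_eq_top.mpr hg, finrank_top]
  rw [hex, h2, h3] at h1
  omega

end Exact

/-- The printed chain of LEMMA 9.2.8 with `x = h⁰(I_{C_t}(D))`, `y = h⁰(O_{Θ_t}(D|_{Θ_t}))`, `z = h⁰(O_{Θ_t}(D|_{Θ_t} − C_t))`:
middle row `8 ≤ x + 4` (⇒ «at least 4»); middle column `y + 0 = 8 − 1`, i.e. `8 = 1 + y` (⇒ «7-dimensional»); bottom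
row `y = z + 4` (⇒ «`= 3`»); left column `x ≤ 1 + z` (⇒ «`≤ 4`»); hence `x = 4`, `y = 7`, `z = 3`.
[cite: Markman2025SecantWeil, Lemma 9.2.8, p. 80 L30 – p. 81 L7] -/
theorem lemma_9_2_8_chain (x y z : ℕ) (hrow : 8 ≤ x + 4) (hcol : 8 = 1 + y) (hbot : y = z + 4)
    (hleft : x ≤ 1 + z) : x = 4 ∧ y = 7 ∧ z = 3 := by
  omega

/-- The same chain with the four sequences as honest linear algebra: vector spaces of dimensions `8` (`H⁰(O_X(D))`),
`4` (`H⁰(O_{C_t}(D))`), `1` (`H⁰(O_X(Θ_s))`) and maps as in the diagram (injective first maps, exact middles, and the two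
printed surjectivities) force `dim H⁰(I_{C_t}(D)) = 4`. [cite: Markman2025SecantWeil, Lemma 9.2.8, p. 80 L30 – p. 81 L7] -/
theorem lemma_9_2_8 {K : Type*} [Field K] {HI HD HC HS HT HTC : Type*} [AddCommGroup HI] [Module K HI]
    [AddCommGroup HD] [Module K HD] [AddCommGroup HC] [Module K HC] [AddCommGroup HS] [Module K HS]
    [AddCommGroup HT] [Module K HT] [AddCommGroup HTC] [Module K HTC] [FiniteDimensional K HI]
    [FiniteDimensional K HD] [FiniteDimensional K HC] [FiniteDimensional K HS] [FiniteDimensional K HT]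
    [FiniteDimensional K HTC]
    (hD : Module.finrank K HD = 8) (hC : Module.finrank K HC = 4) (hS : Module.finrank K HS = 1)
    -- middle row  H⁰(I(D)) → H⁰(O(D)) → H⁰(O_C(D))
    (r₁ : HI →ₗ[K] HD) (r₂ : HD →ₗ[K] HC) (hr₁ : Function.Injective r₁) (hr : LinearMap.ker r₂ = LinearMap.range r₁)
    -- middle column  H⁰(O(Θ_s)) → H⁰(O(D)) → H⁰(O_Θ(D)) → H¹(O(Θ_s)) = 0
    (c₁ : HS →ₗ[K] HD) (c₂ : HD →ₗ[K] HT) (hc₁ : Function.Injective c₁) (hc : LinearMap.ker c₂ = LinearMap.range c₁)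
    (hc₂ : Function.Surjective c₂)
    -- bottom row  H⁰(O_Θ(D − C)) → H⁰(O_Θ(D)) → H⁰(O_C(D)) → H¹(O_Θ(D − C)) = 0
    (b₁ : HTC →ₗ[K] HT) (b₂ : HT →ₗ[K] HC) (hb₁ : Function.Injective b₁) (hb : LinearMap.ker b₂ = LinearMap.range b₁)
    (hb₂ : Function.Surjective b₂)
    -- left column  H⁰(O(Θ_s)) → H⁰(I(D)) → H⁰(O_Θ(D − C))
    (l₁ : HS →ₗ[K] HI) (l₂ : HI →ₗ[K] HTC) (hl₁ : Function.Injective l₁) (hl : LinearMap.ker l₂ = LinearMap.range l₁) :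
    Module.finrank K HI = 4 ∧ Module.finrank K HT = 7 ∧ Module.finrank K HTC = 3 := by
  have hrow := finrank_mid_le r₁ r₂ hr₁ hr
  have hcol := finrank_mid_eq c₁ c₂ hc₁ hc hc₂
  have hbot := finrank_mid_eq b₁ b₂ hb₁ hb hb₂
  have hleft := finrank_mid_le l₁ l₂ hl₁ hl
  rw [hD, hC] at hrow
  rw [hD, hS] at hcol
  rw [hC] at hbot
  rw [hS] at hleft
  omega

/-! ### §C. Lemma 9.1.2, Step 1: the maps `t`, `f`, `u` -/

section Step1

variable {G : Type*} [AddCommGroup G]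

/-- «`t(ℓ₁, ℓ₂, ℓ₃, ℓ₄) = (ℓ₁ + ℓ₂, ℓ₁ + ℓ₃, ℓ₁ + ℓ₄, ℓ₂ + ℓ₃)`» (on `Pic¹(C)⁴ → Pic²(C)⁴`; here on any abelian group).
[cite: Markman2025SecantWeil, Lemma 9.1.2 (proof, Step 1), p. 69 L42–44] -/
def tMap (l : G × G × G × G) : G × G × G × G :=
  (l.1 + l.2.1, l.1 + l.2.2.1, l.1 + l.2.2.2, l.2.1 + l.2.2.1)

/-- «`f(T) = t₁ + t₂ − t₄`». [cite: Markman2025SecantWeil, Lemma 9.1.2 (proof, Step 1), p. 69 L45–46] -/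
def fMap (T : G × G × G × G) : G :=
  T.1 + T.2.1 - T.2.2.2

/-- «`u(T) = (f(T), 2t₁ − f(T), 2t₂ − f(T), 2t₃ − f(T))`». [cite: Markman2025SecantWeil, Lemma 9.1.2 (proof, Step 1), p. 69 L46–47] -/
def uMap (T : G × G × G × G) : G × G × G × G :=
  (fMap T, 2 • T.1 - fMap T, 2 • T.2.1 - fMap T, 2 • T.2.2.1 - fMap T)

/-- «Then `f(t(ℓ₁, ℓ₂, ℓ₃, ℓ₄)) = 2ℓ₁`». [cite: Markman2025SecantWeil, Lemma 9.1.2 (proof, Step 1), p. 69 L48] -/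
theorem f_comp_t (l₁ l₂ l₃ l₄ : G) : fMap (tMap (l₁, l₂, l₃, l₄)) = 2 • l₁ := by
  simp only [fMap, tMap, two_smul]
  abel

/-- «… and `u(t(ℓ₁, ℓ₂, ℓ₃, ℓ₄)) = (2ℓ₁, 2ℓ₂, 2ℓ₃, 2ℓ₄)`». [cite: Markman2025SecantWeil, Lemma 9.1.2 (proof, Step 1), p. 69 L48] -/
theorem u_comp_t (l₁ l₂ l₃ l₄ : G) : uMap (tMap (l₁, l₂, l₃, l₄)) = (2 • l₁, 2 • l₂, 2 • l₃, 2 • l₄) := by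
  simp only [uMap, fMap, tMap, two_smul, Prod.mk.injEq]
  refine ⟨by abel, by abel, by abel, by abel⟩

/-- «It follows that `u ∘ t` is surjective» — as soon as doubling is surjective on the group (for `Pic¹(C)`, a torsor
under the divisible group `Pic⁰(C)`, by value). The further step «and hence so is `t`, as the image of `t` must be 4
dimensional» is a dimension argument taken by value. [cite: Markman2025SecantWeil, Lemma 9.1.2 (proof, Step 1), p. 69 L48–49] -/
theorem u_comp_t_surjective (h2 : Function.Surjective fun x : G => 2 • x) :
    Function.Surjective (uMap ∘ tMap : G × G × G × G → G × G × G × G) := by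
  rintro ⟨a, b, c, e⟩
  obtain ⟨a', ha⟩ := h2 a
  obtain ⟨b', hb⟩ := h2 b
  obtain ⟨c', hc⟩ := h2 c
  obtain ⟨e', he⟩ := h2 e
  refine ⟨(a', b', c', e'), ?_⟩
  simp only [Function.comp_apply, u_comp_t]
  simp only at ha hb hc he
  rw [ha, hb, hc, he]

end Step1

end Literature.AlgebraicGeometry.Markman2025.Lemma928
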